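import Literature.AlgebraicGeometry.Resolution.AlterationsBoundaryDivisor
import Literature.AlgebraicGeometry.Resolution.QuadraticTransformsUFD
import Literature.AlgebraicGeometry.Resolution.StrictNormalCrossingsFlatDescent
import Literature.AlgebraicGeometry.Resolution.StalkSpecializesLocalization
import Literature.AlgebraicGeometry.Resolution.RegularLocalRingsUFD
import Literature.AlgebraicGeometry.Resolution.KollarBlowupSequenceFunctors
import Mathlib.RingTheory.Ideal.UFD
import Mathlib.RingTheory.DiscreteValuationRing.TFAE
import HarnessLib

/-!
# Ideal sheaves of prime divisors on a regular scheme (Cossart–Piltant 2008, proof of Prop. 4.2)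

Topic: `Literature/AlgebraicGeometry/Resolution`. Second brick under the named fact
`CossartPiltant2019Principalization` (`Principalization.lean`), for the first step of the
printed proof of [CoP1] = Cossart–Piltant, J. Algebra 320 (2008), Prop. 4.2 (PDF p. 7):

> "Let `E_1, …, E_m` be the irreducible components of codimension one of `Z := V(I)_red`, and
> `a(j) := ord_{E_j} I`, `1 ≤ j ≤ m`. Then `H := 𝒪_X(-∑ a(i) E_i) ⊆ I` …"

On an integral locally Noetherian scheme `X` whose local rings are factorial (e.g. `X` regular:
Auslander–Buchsbaum, `IsRegularLocalRing.uniqueFactorizationMonoid`, `RegularLocalRingsUFD.lean`)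
a prime divisor `E = cl{ζ}` (`ζ` a point of codimension one, `coheight ζ = dim 𝒪_{X,ζ} = 1`) is
an effective Cartier divisor, and `𝒪_X(-a E) = 𝓘_E^a ⊇ I` as soon as `I_ζ ⊆ 𝔪_ζ^a`. PROVED here:

* `stalkIdeal_map_stalkSpecializes` — `I_ζ = I_x 𝒪_{X,ζ}` along a specialisation `ζ ⤳ x`;
* `primeDivisorIdeal ζ := vanishingIdeal cl{ζ}` — the (radical) ideal sheaf `𝓘_E` of the
  reduced closed subscheme `E = cl{ζ}`; `coe_support_primeDivisorIdeal`;
  `stalkIdeal_primeDivisorIdeal` (`(𝓘_E)_x = 𝔭_ζ`, the prime of the generisation `ζ ⤳ x`,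
  `primeOfSpecializes`, `StrictNormalCrossingsFlatDescent.lean`), `…_self` (`= 𝔪_ζ` at `ζ`),
  `…_eq_top` (`= 𝒪_{X,x}` off `E`);
* `coe_height_primeOfSpecializes` — `ht 𝔭_ζ = coheight ζ` (`𝒪_{X,ζ} = (𝒪_{X,x})_{𝔭_ζ}`,
  `isLocalizationAtPrime_stalkSpecializes`, with Mathlib's `dim 𝒪_{X,ζ} = coheight ζ`);
* `exists_prime_primeOfSpecializes_eq_span` — for `coheight ζ = 1` and `𝒪_{X,x}` factorial,
  `𝔭_ζ = (p)` for a prime element `p` (height-one primes of factorial domains are principal,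
  Mathlib `UniqueFactorizationMonoid.isPrincipal_of_height_eq_one`);
* `isEffectiveCartier_primeDivisorIdeal` — **a prime divisor on an integral locally Noetherian
  locally factorial scheme is an effective Cartier divisor** (Görtz–Wedhorn I, Thm. 11.40 (2):
  Weil divisors on locally factorial schemes are Cartier; via
  `isEffectiveCartier_of_stalkIdeal_eq_span_singleton`, `AlterationsBoundaryDivisor.lean`);
* `exists_stalkIdeal_eq_maximalIdeal_pow` — at a codimension-one point of a regular scheme the
  local ring is a discrete valuation ring, so a non-zero `I` has `I_ζ = 𝔪_ζ^a` with
  `a = ord_ζ I` (`idealOrder`, `MarkedIdeals.lean`) — [CoP1]'s `a(j) = ord_{E_j} I`;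
* `le_primeDivisorIdeal_pow` — **`I_ζ ⊆ 𝔪_ζ^a ⇒ I ⊆ 𝓘_E^a = 𝒪_X(-aE)`** on a regular integral
  locally Noetherian scheme (stalkwise: `p^a ∣ s f` with `p ∤ s` forces `p^a ∣ f` in the
  factorial ring `𝒪_{X,x}`).

## Sources

* V. Cossart, O. Piltant, J. Algebra 320 (2008) 1051–1082, proof of Prop. 4.2 (PDF p. 7).
  [CossartPiltant2008]
* U. Görtz, T. Wedhorn, *Algebraic Geometry I*, 2nd ed. (2020), Def. 11.38 – Thm. 11.40
  (locally factorial schemes; Weil divisors are Cartier), Prop. B.75 (2). [GortzWedhorn2020]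
* The Stacks Project, Tags 01J7 (points of `Spec 𝒪_{X,x}`), 02IZ. [StacksProject]

## What is NOT here

The divisorial part `H = ∏ⱼ 𝓘_{E_j}^{a(j)}` of an ideal sheaf itself (finiteness of the
codimension-one components of `V(I)`, `J := H⁻¹ I`, "`V(J)` has codimension at least two") —
the next brick.
-/

noncomputable section

open CategoryTheory CategoryTheory.Limits AlgebraicGeometry TopologicalSpace IsLocalRing

namespace Literature.AlgebraicGeometry.Resolution

universe u

open Scheme.IdealSheafData

variable {X : Scheme.{u}}

/-! ## Stalks along a specialisation -/

/-- **`I_ζ = I_x · 𝒪_{X,ζ}`**: along a specialisation `ζ ⤳ x`, the stalk of an ideal sheaf at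
`ζ` is the extension of its stalk at `x` under `𝒪_{X,x} → 𝒪_{X,ζ}` (both are generated by the
germs of `I(U)` for an affine open `U ∋ x`, which contains `ζ`). [cite: StacksProject, Tag 01J7] -/
theorem stalkIdeal_map_stalkSpecializes (I : X.IdealSheafData) {ζ x : X} (h : ζ ⤳ x) :
    (stalkIdeal I x).map (X.presheaf.stalkSpecializes h).hom = stalkIdeal I ζ := by
  obtain ⟨U, hU, hxU, -⟩ :=
    exists_isAffineOpen_mem_and_subset (X := X) (x := x) (U := ⊤) (Opens.mem_top x)
  have hζU : ζ ∈ U := h.mem_open U.2 hxU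
  rw [stalkIdeal_eq_map_germ I ⟨U, hU⟩ hxU, stalkIdeal_eq_map_germ I ⟨U, hU⟩ hζU, Ideal.map_map,
    ← CommRingCat.hom_comp, TopCat.Presheaf.germ_stalkSpecializes]

/-! ## The ideal sheaf of the closure of a point -/

/-- **The ideal sheaf `𝓘_E` of the reduced closed subscheme `E = cl{ζ}`** — for `ζ` of
codimension one, the ideal sheaf `𝒪_X(-E)` of the prime (Weil) divisor `E` ([CoP1], proof of
Prop. 4.2: the `E_j`; Görtz–Wedhorn I, (11.13)). [cite: GortzWedhorn2020, Def. 11.38–Thm. 11.40] -/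
def primeDivisorIdeal (ζ : X) : X.IdealSheafData :=
  vanishingIdeal ⟨closure {ζ}, isClosed_closure⟩

/-- The support of `𝓘_E` is `E = cl{ζ}`. [folklore] -/
@[simp] theorem coe_support_primeDivisorIdeal (ζ : X) :
    ((primeDivisorIdeal ζ).support : Set X) = closure {ζ} :=
  coe_support_vanishingIdeal _

/-- `x ∈ supp 𝓘_E` iff `ζ ⤳ x`. [folklore] -/
theorem mem_support_primeDivisorIdeal_iff (ζ x : X) :
    x ∈ (primeDivisorIdeal ζ).support ↔ ζ ⤳ x := by
  rw [← SetLike.mem_coe, coe_support_primeDivisorIdeal, specializes_iff_mem_closure]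

/-- **`(𝓘_E)_x = 𝔭_ζ`** for a specialisation `ζ ⤳ x`: the germ of the vanishing ideal of
`cl{ζ}` is the prime of `𝒪_{X,x}` belonging to the generisation `ζ`. [cite: StacksProject, Tag 01J7] -/
theorem stalkIdeal_primeDivisorIdeal {ζ x : X} (h : ζ ⤳ x) :
    stalkIdeal (primeDivisorIdeal ζ) x = primeOfSpecializes h :=
  stalkIdeal_vanishingIdeal_closure h

/-- At `ζ` itself, `(𝓘_E)_ζ = 𝔪_ζ`. [folklore] -/
theorem stalkIdeal_primeDivisorIdeal_self (ζ : X) :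
    stalkIdeal (primeDivisorIdeal ζ) ζ = maximalIdeal (X.presheaf.stalk ζ) := by
  rw [stalkIdeal_primeDivisorIdeal (specializes_refl ζ), primeOfSpecializes]
  have : X.presheaf.stalkSpecializes (specializes_refl ζ) = 𝟙 _ :=
    X.presheaf.stalkSpecializes_refl ζ
  -- `stalkSpecializes (refl)` is the identity
  ext s
  rw [Ideal.mem_comap, this]
  rfl

/-- Off `E`, `(𝓘_E)_x = 𝒪_{X,x}`. [folklore] -/
theorem stalkIdeal_primeDivisorIdeal_eq_top {ζ x : X} (h : ¬ ζ ⤳ x) :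
    stalkIdeal (primeDivisorIdeal ζ) x = ⊤ :=
  stalkIdeal_eq_top_of_not_mem_support (by rwa [mem_support_primeDivisorIdeal_iff])

/-! ## Heights: `ht 𝔭_ζ = coheight ζ`; codimension-one points -/

/-- **`ht 𝔭_ζ = codim ζ`**: for `ζ ⤳ x`, the prime `𝔭_ζ ⊆ 𝒪_{X,x}` has height the coheight of
`ζ` (`𝒪_{X,ζ}` is the localisation `(𝒪_{X,x})_{𝔭_ζ}`, Stacks 01J7, and `dim 𝒪_{X,ζ} = coheight ζ`,
Stacks 02IZ). [cite: StacksProject, Tag 02IZ] -/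
theorem coe_height_primeOfSpecializes {ζ x : X} (h : ζ ⤳ x) :
    ((primeOfSpecializes h).height : WithBot ℕ∞) = Order.coheight ζ := by
  letI := (X.presheaf.stalkSpecializes h).hom.toAlgebra
  haveI : IsLocalization.AtPrime (X.presheaf.stalk ζ) (primeOfSpecializes h) :=
    isLocalizationAtPrime_stalkSpecializes h
  rw [← IsLocalization.AtPrime.ringKrullDim_eq_height (primeOfSpecializes h) (X.presheaf.stalk ζ),
    ringKrullDim_stalk_eq_coheight]

/-- For `ζ` of codimension one, `𝔭_ζ` is a height-one prime of `𝒪_{X,x}`. [folklore] -/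
theorem height_primeOfSpecializes_eq_one {ζ x : X} (h : ζ ⤳ x) (hζ : Order.coheight ζ = 1) :
    (primeOfSpecializes h).height = 1 := by
  have := coe_height_primeOfSpecializes h
  rw [hζ] at this
  exact_mod_cast this

/-- **In a factorial local ring `𝒪_{X,x}`, the prime `𝔭_ζ` of a codimension-one generisation is
principal, generated by a prime element** (Görtz–Wedhorn I, Prop. B.75 (2): height-one primes of
a factorial domain are principal). [cite: GortzWedhorn2020, Prop. B.75 (2)] -/
theorem exists_prime_primeOfSpecializes_eq_span {ζ x : X} (h : ζ ⤳ x) (hζ : Order.coheight ζ = 1)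
    [IsDomain (X.presheaf.stalk x)] [UniqueFactorizationMonoid (X.presheaf.stalk x)] :
    ∃ p : X.presheaf.stalk x, Prime p ∧ primeOfSpecializes h = Ideal.span {p} := by
  have h1 := height_primeOfSpecializes_eq_one h hζ
  obtain ⟨p, hp⟩ := UniqueFactorizationMonoid.isPrincipal_of_height_eq_one h1
  have hp' : primeOfSpecializes h = Ideal.span {p} := hp
  have hne : primeOfSpecializes h ≠ ⊥ := Ideal.ne_bot_of_height_eq_one h1
  refine ⟨p, ?_, hp'⟩
  rw [hp', Ne, Ideal.span_singleton_eq_bot] at hne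
  exact (Ideal.span_singleton_prime hne).mp (hp' ▸ inferInstance)

/-- On an integral locally Noetherian scheme with factorial local rings, the stalks of `𝓘_E`
(`E = cl{ζ}`, `coheight ζ = 1`) at the points of `E` are non-zero principal ideals `(p)`.
[cite: GortzWedhorn2020, Def. 11.38–Thm. 11.40] -/
theorem exists_stalkIdeal_primeDivisorIdeal_eq_span [IsIntegral X]
    (hX : ∀ x : X, UniqueFactorizationMonoid (X.presheaf.stalk x)) {ζ x : X} (h : ζ ⤳ x)
    (hζ : Order.coheight ζ = 1) :
    ∃ p : X.presheaf.stalk x, Prime p ∧ stalkIdeal (primeDivisorIdeal ζ) x = Ideal.span {p} := by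
  haveI := hX x
  obtain ⟨p, hp, hpeq⟩ := exists_prime_primeOfSpecializes_eq_span h hζ
  exact ⟨p, hp, (stalkIdeal_primeDivisorIdeal h).trans hpeq⟩

/-- **A prime divisor on an integral locally Noetherian locally factorial scheme is an effective
Cartier divisor**: `𝓘_E` is locally generated by one non-zero-divisor (Görtz–Wedhorn I,
Thm. 11.40 (2); Hartshorne II, Prop. 6.11). [cite: GortzWedhorn2020, Thm. 11.40 (2)] -/
theorem isEffectiveCartier_primeDivisorIdeal [IsIntegral X] [IsLocallyNoetherian X]
    (hX : ∀ x : X, UniqueFactorizationMonoid (X.presheaf.stalk x)) {ζ : X}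
    (hζ : Order.coheight ζ = 1) : IsEffectiveCartier (primeDivisorIdeal ζ) := by
  refine isEffectiveCartier_of_stalkIdeal_eq_span_singleton fun x hx => ?_
  rw [mem_support_primeDivisorIdeal_iff] at hx
  obtain ⟨p, hp, hpeq⟩ := exists_stalkIdeal_primeDivisorIdeal_eq_span hX hx hζ
  exact ⟨p, hp.ne_zero, hpeq⟩

/-- A regular scheme has factorial local rings (Auslander–Buchsbaum). [cite: Matsumura1987, Thm. 20.3] -/
theorem Scheme.IsRegular.uniqueFactorizationMonoid_stalk (hX : Scheme.IsRegular X) (x : X) :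
    UniqueFactorizationMonoid (X.presheaf.stalk x) :=
  haveI := hX x
  IsRegularLocalRing.uniqueFactorizationMonoid (X.presheaf.stalk x)

/-- On a regular integral locally Noetherian scheme, prime divisors are effective Cartier
divisors. [cite: GortzWedhorn2020, Thm. 11.40 (2)] -/
theorem isEffectiveCartier_primeDivisorIdeal_of_isRegular [IsIntegral X]
    [IsLocallyNoetherian X] (hX : Scheme.IsRegular X) {ζ : X} (hζ : Order.coheight ζ = 1) :
    IsEffectiveCartier (primeDivisorIdeal ζ) :=
  isEffectiveCartier_primeDivisorIdeal hX.uniqueFactorizationMonoid_stalk hζ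

/-! ## The order of an ideal along a prime divisor -/

/-- The local ring of a regular scheme at a codimension-one point is a principal ideal ring (a
discrete valuation ring). [folklore] -/
theorem isPrincipalIdealRing_stalk_of_coheight_eq_one (hX : Scheme.IsRegular X) {ζ : X}
    (hζ : Order.coheight ζ = 1) : IsPrincipalIdealRing (X.presheaf.stalk ζ) := by
  haveI := hX ζ
  refine isPrincipalIdealRing_of_ringKrullDim_le_one (R := X.presheaf.stalk ζ) ?_
  rw [ringKrullDim_stalk_eq_coheight, hζ]
  exact le_of_eq (by rfl)

/-- In a Noetherian local domain which is not a field, the powers of the maximal ideal strictly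
decrease: `𝔪ⁿ⁺¹ ≠ 𝔪ⁿ` (Nakayama). [folklore] -/
theorem maximalIdeal_pow_succ_ne {R : Type*} [CommRing R] [IsLocalRing R] [IsNoetherianRing R]
    [IsDomain R] (hR : ¬ IsField R) (n : ℕ) : maximalIdeal R ^ (n + 1) ≠ maximalIdeal R ^ n := by
  intro h
  have hm : maximalIdeal R ≠ ⊥ := fun hb => hR (isField_iff_maximalIdeal_eq.mpr hb)
  -- Nakayama: `𝔪 · 𝔪ⁿ = 𝔪ⁿ` forces `𝔪ⁿ = 0`
  have h0 : maximalIdeal R ^ n = ⊥ := by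
    refine Submodule.eq_bot_of_le_smul_of_le_jacobson_bot (maximalIdeal R) _
      (IsNoetherian.noetherian _) ?_ (maximalIdeal_le_jacobson ⊥)
    rw [Ideal.smul_eq_mul, ← pow_succ']
    exact h.ge
  rcases Nat.eq_zero_or_pos n with rfl | hn
  · rw [pow_zero, Ideal.one_eq_top] at h0
    exact top_ne_bot h0
  · exact hm ((pow_eq_zero_iff hn.ne').mp h0)

/-- The local ring at a codimension-one point is not a field (`dim 𝒪_{X,ζ} = 1`). [folklore] -/
theorem not_isField_stalk_of_coheight_eq_one {ζ : X} (hζ : Order.coheight ζ = 1) :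
    ¬ IsField (X.presheaf.stalk ζ) := by
  intro hf
  have hb := isField_iff_maximalIdeal_eq.mp hf
  have h0 : ringKrullDim (X.presheaf.stalk ζ) = 0 := by
    rw [← IsLocalRing.maximalIdeal_height_eq_ringKrullDim, hb, Ideal.height_bot]
    rfl
  rw [ringKrullDim_stalk_eq_coheight, hζ] at h0
  simp at h0

/-- **`I_ζ = 𝔪_ζ^{a}` with `a = ord_ζ I`** ([CoP1]: "`a(j) := ord_{E_j} I`"): at a
codimension-one point `ζ` of a regular integral scheme the local ring is a discrete valuation
ring, so the stalk of a non-zero ideal sheaf is the power `𝔪_ζ^a` of the maximal ideal with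
`a = ord_ζ(I)` (`idealOrder`). [cite: CossartPiltant2008, proof of Prop. 4.2] -/
theorem exists_stalkIdeal_eq_maximalIdeal_pow [IsIntegral X] (hX : Scheme.IsRegular X) {ζ : X}
    (hζ : Order.coheight ζ = 1) {I : X.IdealSheafData} (hI : I ≠ ⊥) :
    ∃ a : ℕ, idealOrder I ζ = a ∧ stalkIdeal I ζ = maximalIdeal (X.presheaf.stalk ζ) ^ a := by
  haveI := hX ζ
  haveI := isPrincipalIdealRing_stalk_of_coheight_eq_one hX hζ
  have hnf := not_isField_stalk_of_coheight_eq_one (X := X) hζ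
  have h06 := (tfae_of_isNoetherianRing_of_isLocalRing_of_isDomain (X.presheaf.stalk ζ)).out 0 6
  have hpow : ∀ J : Ideal (X.presheaf.stalk ζ), J ≠ ⊥ →
      ∃ n : ℕ, J = maximalIdeal (X.presheaf.stalk ζ) ^ n := h06.mp ‹_›
  obtain ⟨a, ha⟩ := hpow (stalkIdeal I ζ) (stalkIdeal_ne_bot_of_ne_bot hI ζ)
  refine ⟨a, le_antisymm ?_ ((le_idealOrder_iff I ζ a).mpr ha.le), ha⟩
  -- `ord_ζ I ≤ a`: otherwise `𝔪^a = I_ζ ⊆ 𝔪^{a+1}`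
  by_contra hlt
  have h1 : ((a + 1 : ℕ) : ℕ∞) ≤ idealOrder I ζ := by
    rw [Nat.cast_succ]
    exact Order.add_one_le_of_lt (not_le.mp hlt)
  rw [le_idealOrder_iff, ha] at h1
  exact maximalIdeal_pow_succ_ne hnf a
    (le_antisymm (Ideal.pow_le_pow_right (Nat.le_succ a)) h1)

/-! ## `I_ζ ⊆ 𝔪_ζ^a` forces `I ⊆ 𝓘_E^a` -/

/-- Ring-level form: for the localisation `S = R_P` of a domain at the principal prime
`P = (p)`, an element `f ∈ R` with `f ∈ Pⁿ S` is divisible by `pⁿ` (`s f = a ∈ (pⁿ)` with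
`s ∉ (p)`, and `p` is prime). [folklore] -/
theorem pow_dvd_of_algebraMap_mem_map_pow {R : Type*} [CommRing R] [IsDomain R] {S : Type*}
    [CommRing S] [Algebra R S] (P : Ideal R) [P.IsPrime] [IsLocalization.AtPrime S P] {p : R}
    (hp : Prime p) (hP : P = Ideal.span {p}) {f : R} {n : ℕ}
    (hf : algebraMap R S f ∈ (P ^ n).map (algebraMap R S)) : p ^ n ∣ f := by
  obtain ⟨⟨⟨a, ha⟩, s⟩, hs⟩ := (IsLocalization.mem_map_algebraMap_iff P.primeCompl S).mp hf
  simp only at hs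
  have hfs : algebraMap R S (f * s) = algebraMap R S a := by rw [map_mul, hs]
  obtain ⟨c, hc⟩ := (IsLocalization.eq_iff_exists P.primeCompl S).mp hfs
  rw [hP, Ideal.span_singleton_pow, Ideal.mem_span_singleton] at ha
  have hdvd : p ^ n ∣ ((c : R) * s) * f := by
    have : p ^ n ∣ (c : R) * a := dvd_mul_of_dvd_right ha _
    rw [← hc] at this
    convert this using 1
    ring
  have hc' : (c : R) ∉ P := Ideal.mem_primeCompl_iff.mp c.2
  have hs' : (s : R) ∉ P := Ideal.mem_primeCompl_iff.mp s.2
  have hcs : ¬ p ∣ (c : R) * s := fun h => (hp.dvd_or_dvd h).elim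
    (fun h1 => hc' (hP.ge (Ideal.mem_span_singleton.mpr h1)))
    (fun h2 => hs' (hP.ge (Ideal.mem_span_singleton.mpr h2)))
  exact hp.pow_dvd_of_dvd_mul_left n hcs hdvd

/-- **`I_ζ ⊆ 𝔪_ζ^a ⇒ I ⊆ 𝓘_E^a = 𝒪_X(-aE)`** ([CoP1], proof of Prop. 4.2:
"`H := 𝒪_X(-∑ a(i)E_i) ⊆ I`", one prime divisor at a time) on an integral scheme with factorial
local rings: at `x ∈ E`, `(𝓘_E^a)_x = (p^a)` and every `f ∈ I_x` satisfies `p^a ∣ f`, since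
`f ∈ I_ζ = I_x 𝒪_{X,ζ} ⊆ 𝔪_ζ^a = (p)^a 𝒪_{X,ζ}` with `𝒪_{X,ζ} = (𝒪_{X,x})_{(p)}`; off `E` the
right-hand side is `𝒪_{X,x}`. [cite: CossartPiltant2008, proof of Prop. 4.2] -/
theorem le_primeDivisorIdeal_pow [IsIntegral X]
    (hX : ∀ x : X, UniqueFactorizationMonoid (X.presheaf.stalk x)) {ζ : X}
    (hζ : Order.coheight ζ = 1) {I : X.IdealSheafData} {n : ℕ}
    (hn : stalkIdeal I ζ ≤ maximalIdeal (X.presheaf.stalk ζ) ^ n) :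
    I ≤ primeDivisorIdeal ζ ^ n := by
  refine le_of_forall_stalkIdeal_le fun x => ?_
  rw [stalkIdeal_pow]
  by_cases h : ζ ⤳ x
  · haveI := hX x
    obtain ⟨p, hp, hpeq⟩ := exists_prime_primeOfSpecializes_eq_span h hζ
    rw [stalkIdeal_primeDivisorIdeal h, hpeq, Ideal.span_singleton_pow]
    intro f hf
    rw [Ideal.mem_span_singleton]
    letI := (X.presheaf.stalkSpecializes h).hom.toAlgebra
    haveI : IsLocalization.AtPrime (X.presheaf.stalk ζ) (primeOfSpecializes h) :=
      isLocalizationAtPrime_stalkSpecializes h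
    refine pow_dvd_of_algebraMap_mem_map_pow (S := X.presheaf.stalk ζ) (primeOfSpecializes h)
      hp hpeq ?_
    have h1 : algebraMap _ (X.presheaf.stalk ζ) f ∈ stalkIdeal I ζ := by
      rw [← stalkIdeal_map_stalkSpecializes I h]
      exact Ideal.mem_map_of_mem _ hf
    have h2 := hn h1
    rwa [← IsLocalization.AtPrime.map_eq_maximalIdeal (primeOfSpecializes h) (X.presheaf.stalk ζ),
      ← Ideal.map_pow] at h2
  · rw [stalkIdeal_primeDivisorIdeal_eq_top h, Ideal.top_pow]
    exact le_top

/-- The same on a regular integral scheme, with the exponent `a = ord_ζ I` of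
`exists_stalkIdeal_eq_maximalIdeal_pow`: **`I ⊆ 𝓘_E^{ord_E I}`**.
[cite: CossartPiltant2008, proof of Prop. 4.2] -/
theorem le_primeDivisorIdeal_pow_of_isRegular [IsIntegral X] (hX : Scheme.IsRegular X)
    {ζ : X} (hζ : Order.coheight ζ = 1) {I : X.IdealSheafData} {n : ℕ}
    (hn : stalkIdeal I ζ ≤ maximalIdeal (X.presheaf.stalk ζ) ^ n) :
    I ≤ primeDivisorIdeal ζ ^ n :=
  le_primeDivisorIdeal_pow hX.uniqueFactorizationMonoid_stalk hζ hn

end Literature.AlgebraicGeometry.Resolution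

end
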